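import Summits.QuantumFields.YangMills.Theorems.UnitScaleTiltProp8ChartDoubleBarSU2
import HarnessLib

/-!
# K0⁷ STUB 1 (`stub_prop8StepCoP13`), sub-target S4a — **THE BLOCK FRAMES OF THE DOUBLE-BAR TOWER IN `SU(N)`, GENERIC `N`** (the `hvf` hypotheses of this seat's ♭ → (0.4) fibre
# dictionary `…K0Stub1DoubleBarFibreAtRecord`): UST's `SU(2)` predicate propagation (✓`Prop8ChartDoubleBar.pred_dbarAvgU` ∕ `pred_dbarIterU_of_reads`,
# ✓`HalvingCompetitorMapFramesSU2.pred_vframeU(_dbarIterU)`) PORTED to a generic complete normed algebra with a DISPLAYED LOGARITHM GUARD `θ` (the `N`-dependent winding guard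
# `δ_N = min(1∕3, π∕N)` of the (0.4) series logarithm replaces `card (Fin 2)·(1∕3) < π`), then instantiated at «the matrix is in `SU(N)`»

Cell `pub-ymgap`, width seat `pub-ymgap-k0-s1-w1` g7 (CLAIM-3).  `--kind proof --supports stmt-QuantumFields-20541 --as helper`; count-neutral.  [B7AVG] = [Balaban1985Averaging];
[I] = [Balaban1987RG1].

WHY.  File 2 of this seat's ♭-road bricks (`exists_suGauge_family_iter_eq`) displays `hvf`: the block frames `v(U̿^{(j)}(e^{iηA}))(z)` of the double-bar tower lie in `SU(N)` on the
small-readable blocks `z ∈ Ω_{j+1}`.  The `ym3-torus` cell proved this for `M₂(ℂ)` (`su2_vframeU_dbarIterU`), where the winding guard of the series logarithm is automatic below `1∕3`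
(`2·(1∕3) < π`).  For `SU(N)` the exponent `|I|⁻¹Σ log W_i` is traceless only under `N·‖W_i − 1‖ < π` (lit ✓`ExpMeanLog.eml_mem_specialUnitaryGroup`, ✓`trace_mlog_eq_zero`), i.e. the
tree's (0.4) guard `δ_N`.  This file re-runs the four UST propagation lemmas for a generic algebra `𝔸` with the `eml`-stability of the predicate assumed below a displayed threshold
`θ` (`heml`), the near-flatness budget sharpened so that every loop ∕ centre-stair variable is within `θ` of `1`, and instantiates at `𝔸 = M_N(ℂ)`, `p` = «`∈ SU(N)`», `θ < δ_N`.

WHAT IS PROVED (sorry-free; no definition; axioms standard; generic `P`; §1–§2 generic complete normed ℂ-algebra `𝔸` with `‖1‖ = 1`).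
* §1 `pred_dbarAvgU_of_le` (one (89) step: `p` and `s`-near-flatness on the two-block bonds, `4ℓs ≤ θ ≤ 1∕3` ⇒ `p (U̿(c))`), `pred_vframeU_of_le` (the frame (110) at one block),
  ★ `pred_dbarIterU_of_reads_of_le` (the tower on a read territory, budget `8·3800·ℓ²·Lⁱ·s₀ ≤ 1` AND `8ℓ·Lⁱ·s₀ ≤ θ`), ★ `pred_vframeU_dbarIterU_of_le` (the frame of `U̿^{(j)}U` at a
  `(j+1)`-block whose fine bonds are `s₀`-near-flat and satisfy `p`; budgets at `L^{j+1}`).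
* §2 `suN_pred_one ∕ _mul ∕ _inv ∕ _eml` (the predicate «`∃ s : SU(N), ↑s = ↑u`» on `M_N(ℂ)ˣ`: multiplicative, inverse-closed, `eml`-stable below any `θ < δ_N`),
  ★★ `suN_vframeU_dbarIterU` — **THE FRAME IS IN `SU(N)`** when the fine field is `SU(N)`-valued and `s₀`-near-flat under the block with `8·3800·ℓ²·L^{j+1}·s₀ ≤ 1` and
  `8ℓ·L^{j+1}·s₀ < δ_N` = file 2's `hvf` at one block.
HONEST SCOPE.  A port (bookkeeping over UST's landed one-step letters ✓`norm_loopHolU_sub_one_le`, ✓`norm_holT_stair_sub_one_le`, ✓`norm_dbarIterU_sub_one_le_two_mul₀`,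
✓`holT_pred_of_walk` and lit ✓`eml_mem_specialUnitaryGroup`); NO estimate of Bałaban's asserted; `stub_prop8StepCoP13` ∕ K0⁷ NOT closed; N07 NOT discharged; counts unmoved (28∕28 · 5∕27);
R4 closes the conditional finite-𝕋⁴ rung `BalabanLadder.UV` only; the YM mass gap (Clay) is NOT proved by any of this; nothing continuum ∕ ℝ⁴ ∕ OS.  No `sorry`, no `def`, no
`instance`, no `notation`.

References: [B7AVG] T. Bałaban, CMP **98** (1985) 17–51 ((8)–(9), (11) p.19, (19)–(23) p.21, (89) p.31, (110) p.34, (122)–(123) p.36, Prop. 4 (134)–(135) p.38);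
[I] CMP **109** (1987) 249–301 ((0.3)–(0.9) pp.252–253, (0.11) p.253).
-/

set_option autoImplicit false

noncomputable section

open scoped BigOperators Matrix.Norms.L2Operator
open NormedSpace

namespace Summit.QuantumFields.YangMills.Theorems.K0Stub1DoubleBarFramesSU

open Literature.MathematicalPhysics.QuantumFieldTheory.Balaban1983to89
open T4Continuum BlockAveraging ExpMeanLog MatrixLog
open B10Eq27TorusAxialLog (holT)
open B5Eq118OneStroke (iterBlockOf iterBlockOf_succ iterBlockOf_zero)
open Summit.QuantumFields.YangMills.Theorems.Prop8Chart
open Summit.QuantumFields.YangMills.Theorems.Prop8ChartDoubleBar (vframeU coe_vframeU dbarAvgU coe_dbarAvgU dbarIterU dbarIterU_zero dbarIterU_succ holT_pred_of_walk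
  norm_holT_stair_sub_one_le norm_dbarIterU_sub_one_le_two_mul₀)

variable {P : Params}

/-! ## §1 Predicate propagation with a displayed logarithm guard `θ` (generic algebra) -/

section Generic

variable {𝔸 : Type*} [NormedRing 𝔸] [NormedAlgebra ℂ 𝔸] [CompleteSpace 𝔸] [NormOneClass 𝔸]
  (p : 𝔸 → Prop) (h1 : p 1) (hmul : ∀ a b, p a → p b → p (a * b)) (hinv : ∀ u : 𝔸ˣ, p (u : 𝔸) → p ((u⁻¹ : 𝔸ˣ) : 𝔸))
  {θ : ℝ} (hθ : θ ≤ 1) (heml : ∀ W : Idx P → 𝔸, (∀ i, p (W i)) → (∀ i, ‖W i - 1‖ ≤ θ) → p (eml W))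

include h1 hmul hinv in
omit [NormedAlgebra ℂ 𝔸] [CompleteSpace 𝔸] [NormOneClass 𝔸] in
/-- a multiplicative inverse-closed predicate read along a walk passes to the units-valued transporter (✓`holT_pred_of_walk`). [cite: Balaban1985Averaging, (8)-(9) p.19] -/
theorem pred_holT {j : ℕ} (S : GaugeField P j 𝔸ˣ) (x : Site P j) (w : List (Letter P.d)) (hw : ∀ st ∈ walk x w, p ((S st.bond : 𝔸ˣ) : 𝔸)) :
    p ((holT S x w : 𝔸ˣ) : 𝔸) :=
  holT_pred_of_walk (fun u : 𝔸ˣ => p (u : 𝔸)) (by rw [Units.val_one]; exact h1) (fun a b ha hb => by rw [Units.val_mul]; exact hmul _ _ ha hb) hinv S x w hw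

include h1 hmul hinv hθ heml in
/-- **THE BLOCK FRAME (110) SATISFIES `p`** (one block): `p` on and `s`-near-flatness of the level-`j` field on the bonds inside `B(y)`, `4ℓs ≤ θ` (`θ ≤ 1`) ⇒ `p (v(S)(y))` — the
centre stairs stay in the block, are products of block bonds and within `4ℓs ≤ θ` of `1`. [cite: Balaban1985Averaging, (110) p.34, (122)-(123) p.36; Balaban1987RG1, (0.3) p.252] -/
theorem pred_vframeU_of_le {j : ℕ} (hj : j + 1 ≤ P.m + P.K) (S : GaugeField P j 𝔸ˣ) (y : Site P (j + 1)) {s : ℝ} (hs0 : 0 ≤ s)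
    (hℓs : 4 * (((P.d + 2) * P.L : ℕ) : ℝ) * s ≤ θ)
    (hS : ∀ b : PBond P j, blockOf b.src = y → blockOf b.tgt = y → ‖((S b : 𝔸ˣ) : 𝔸) - 1‖ ≤ s)
    (hp : ∀ b : PBond P j, blockOf b.src = y → blockOf b.tgt = y → p ((S b : 𝔸ˣ) : 𝔸)) :
    p ((vframeU S y : 𝔸ˣ) : 𝔸) := by
  have hℓs4 : 4 * (((P.d + 2) * P.L : ℕ) : ℝ) * s ≤ 1 := hℓs.trans hθ
  rw [coe_vframeU]
  refine heml _ (fun i => pred_holT p h1 hmul hinv S _ _ fun st hst => hp st.bond ?_ ?_) fun i => ((norm_holT_stair_sub_one_le hj y hs0 hℓs4 hS i).1).trans hℓs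
  · exact (blockOf_ends_of_mem_stairWalk hj y i.1 i.2.1 st hst).1
  · exact (blockOf_ends_of_mem_stairWalk hj y i.1 i.2.1 st hst).2

include h1 hmul hinv hθ heml in
/-- **ONE DOUBLE-BAR STEP PRESERVES `p`** on the two blocks of `c`: `p` on the two-block bonds, which are within `s` of `1`, `4ℓs ≤ θ ≤ 1` ⇒ `p (U̿(c))` (`U̿(c) = v(c₋)⁻¹·Ū(c)·v(c₊)`:
the loops and the straight transporter by ✓`norm_loopHolU_sub_one_le`, the frames by the previous lemma). [cite: Balaban1987RG1, (0.4)-(0.9) p.253; Balaban1985Averaging, (89) p.31, (110) p.34] -/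
theorem pred_dbarAvgU_of_le {j : ℕ} (hj : j + 1 ≤ P.m + P.K) {S : GaugeField P j 𝔸ˣ} (c : PBond P (j + 1)) {s : ℝ} (hs0 : 0 ≤ s)
    (hℓs : 4 * (((P.d + 2) * P.L : ℕ) : ℝ) * s ≤ θ)
    (hS : ∀ b : PBond P j, (blockOf b.src = c.src ∨ blockOf b.src = c.tgt) → (blockOf b.tgt = c.src ∨ blockOf b.tgt = c.tgt) → ‖((S b : 𝔸ˣ) : 𝔸) - 1‖ ≤ s)
    (hp : ∀ b : PBond P j, (blockOf b.src = c.src ∨ blockOf b.src = c.tgt) → (blockOf b.tgt = c.src ∨ blockOf b.tgt = c.tgt) → p ((S b : 𝔸ˣ) : 𝔸)) :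
    p ((dbarAvgU S c : 𝔸ˣ) : 𝔸) := by
  have hℓs4 : 4 * (((P.d + 2) * P.L : ℕ) : ℝ) * s ≤ 1 := hℓs.trans hθ
  -- the frames at the two ends
  have hframe : ∀ y : Site P (j + 1), (y = c.src ∨ y = c.tgt) → p ((vframeU S y : 𝔸ˣ) : 𝔸) := by
    intro y hy
    refine pred_vframeU_of_le p h1 hmul hinv hθ heml hj S y hs0 hℓs (fun b hb1 hb2 => hS b ?_ ?_) fun b hb1 hb2 => hp b ?_ ?_
    · rw [hb1]; exact hy
    · rw [hb2]; exact hy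
    · rw [hb1]; exact hy
    · rw [hb2]; exact hy
  -- the single-bar average: `eml` of the loops times the straight transporter
  have havg : p ((emlAvgU S c : 𝔸ˣ) : 𝔸) := by
    rw [coe_emlAvgU]
    refine hmul _ _ (heml _ (fun i => ?_) fun i => ((norm_loopHolU_sub_one_le hj c hs0 hℓs4 hS i).1).trans hℓs) ?_
    · exact pred_holT p h1 hmul hinv S _ _ fun st hst => hp st.bond (two_block_of_mem_loopWalk hj c i hst).1 (two_block_of_mem_loopWalk hj c i hst).2
    · exact pred_holT p h1 hmul hinv S _ _ fun st hst => hp st.bond (two_block_of_mem_lineWalk hj c hst).1 (two_block_of_mem_lineWalk hj c hst).2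
  rw [coe_dbarAvgU]
  exact hmul _ _ (hmul _ _ (hinv _ (hframe c.src (Or.inl rfl))) havg) (hframe c.tgt (Or.inr rfl))

include h1 hmul hinv hθ heml in
/-- ★ **THE DOUBLE-BAR TOWER PRESERVES `p` ON THE READ TERRITORY** with the logarithm guard: `p` on and `s₀`-near-flatness of the fine field on every fine bond whose level-`i` blocks
lie in `S`, budgets `8·3800·ℓ²·Lⁱ·s₀ ≤ 1` (B2) and `8ℓ·Lⁱ·s₀ ≤ θ` (guard) ⇒ `p (U̿^{(i)}(e))` for every `e` with both ends in `S`.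
[cite: Balaban1985Averaging, Prop. 4 (134)-(135) p.38; Balaban1987RG1, (0.9) p.253] -/
theorem pred_dbarIterU_of_reads_of_le :
    ∀ (i : ℕ), i ≤ P.m + P.K → ∀ (S : Set (Site P i)) (U : GaugeField P 0 𝔸ˣ) (s₀ : ℝ), 0 ≤ s₀ →
      8 * 3800 * (((P.d + 2) * P.L : ℕ) : ℝ) ^ 2 * (P.L : ℝ) ^ i * s₀ ≤ 1 →
      8 * (((P.d + 2) * P.L : ℕ) : ℝ) * (P.L : ℝ) ^ i * s₀ ≤ θ →
      (∀ b : PBond P 0, iterBlockOf i b.src ∈ S → iterBlockOf i b.tgt ∈ S → ‖((U b : 𝔸ˣ) : 𝔸) - 1‖ ≤ s₀) →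
      (∀ b : PBond P 0, iterBlockOf i b.src ∈ S → iterBlockOf i b.tgt ∈ S → p ((U b : 𝔸ˣ) : 𝔸)) →
      ∀ e : PBond P i, e.src ∈ S → e.tgt ∈ S → p ((dbarIterU i U e : 𝔸ˣ) : 𝔸) := by
  set ℓ : ℝ := (((P.d + 2) * P.L : ℕ) : ℝ) with hℓ
  have hL1 : (1 : ℝ) ≤ P.L := by exact_mod_cast P.L_pos
  intro i
  induction i with
  | zero =>
    intro _ S U s₀ _ _ _ _ hpU e hs ht
    rw [dbarIterU_zero]
    exact hpU e (by simpa only [iterBlockOf_zero] using hs) (by simpa only [iterBlockOf_zero] using ht)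
  | succ i ih =>
    intro hi S U s₀ hs₀ hbudget hguard hU hpU c hcs hct
    have hpow : (P.L : ℝ) ^ i ≤ (P.L : ℝ) ^ (i + 1) := pow_le_pow_right₀ hL1 (Nat.le_succ i)
    have hbudget_i : 8 * 3800 * ℓ ^ 2 * (P.L : ℝ) ^ i * s₀ ≤ 1 := by
      refine le_trans ?_ hbudget
      have h0 : 0 ≤ 8 * 3800 * ℓ ^ 2 * s₀ := by positivity
      nlinarith
    have hguard_i : 8 * ℓ * (P.L : ℝ) ^ i * s₀ ≤ θ := by
      refine le_trans ?_ hguard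
      have h0 : 0 ≤ 8 * ℓ * s₀ := by positivity
      nlinarith
    set S' : Set (Site P i) := {y | blockOf y ∈ S} with hS'
    have hU' : ∀ b : PBond P 0, iterBlockOf i b.src ∈ S' → iterBlockOf i b.tgt ∈ S' → ‖((U b : 𝔸ˣ) : 𝔸) - 1‖ ≤ s₀ :=
      fun b hs ht => hU b (by rw [iterBlockOf_succ]; exact hs) (by rw [iterBlockOf_succ]; exact ht)
    have hpU' : ∀ b : PBond P 0, iterBlockOf i b.src ∈ S' → iterBlockOf i b.tgt ∈ S' → p ((U b : 𝔸ˣ) : 𝔸) :=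
      fun b hs ht => hpU b (by rw [iterBlockOf_succ]; exact hs) (by rw [iterBlockOf_succ]; exact ht)
    have hF : ∀ e : PBond P i, e.src ∈ S' → e.tgt ∈ S' → p ((dbarIterU i U e : 𝔸ˣ) : 𝔸) :=
      ih (Nat.le_of_succ_le hi) S' U s₀ hs₀ hbudget_i hguard_i hU' hpU'
    have hnear : ∀ e : PBond P i, e.src ∈ S' → e.tgt ∈ S' → ‖((dbarIterU i U e : 𝔸ˣ) : 𝔸) - 1‖ ≤ 2 * ((P.L : ℝ) ^ i * s₀) :=
      fun e hs ht => norm_dbarIterU_sub_one_le_two_mul₀ (Nat.le_of_succ_le hi) S' U hs₀ hbudget_i hU' e hs ht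
    rw [dbarIterU_succ]
    have hmem : ∀ b : PBond P i, (blockOf b.src = c.src ∨ blockOf b.src = c.tgt) → (blockOf b.tgt = c.src ∨ blockOf b.tgt = c.tgt) → b.src ∈ S' ∧ b.tgt ∈ S' := by
      intro b hbs hbt
      constructor
      · show blockOf b.src ∈ S
        rcases hbs with h | h <;> rw [h]
        exacts [hcs, hct]
      · show blockOf b.tgt ∈ S
        rcases hbt with h | h <;> rw [h]
        exacts [hcs, hct]
    have h2x : 0 ≤ 2 * ((P.L : ℝ) ^ i * s₀) := by positivity
    have h4 : 4 * (((P.d + 2) * P.L : ℕ) : ℝ) * (2 * ((P.L : ℝ) ^ i * s₀)) ≤ θ := by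
      rw [← hℓ]
      have : 4 * ℓ * (2 * ((P.L : ℝ) ^ i * s₀)) = 8 * ℓ * (P.L : ℝ) ^ i * s₀ := by ring
      rw [this]; exact hguard_i
    exact pred_dbarAvgU_of_le p h1 hmul hinv hθ heml hi c h2x h4 (fun b hbs hbt => hnear b (hmem b hbs hbt).1 (hmem b hbs hbt).2)
      fun b hbs hbt => hF b (hmem b hbs hbt).1 (hmem b hbs hbt).2

include h1 hmul hinv hθ heml in
/-- ★ **THE FRAME OF `U̿^{(j)}U` AT A `(j+1)`-BLOCK WHOSE FINE BONDS ARE SMALL AND SATISFY `p`**: budgets `8·3800·ℓ²·L^{j+1}·s₀ ≤ 1` and `8ℓ·L^{j+1}·s₀ ≤ θ` ⇒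
`p (v(U̿^{(j)}U)(z))` — the level-`j` double-bar field is `2Lʲs₀`-near-flat and satisfies `p` on the `j`-bonds inside `z`, then the one-block frame lemma.
[cite: Balaban1985Averaging, Prop. 4 (134)-(135) p.38, (110) p.34; Balaban1987RG1, (0.9) p.253] -/
theorem pred_vframeU_dbarIterU_of_le {j : ℕ} (hj : j + 1 ≤ P.m + P.K) (z : Site P (j + 1)) (U : GaugeField P 0 𝔸ˣ) {s₀ : ℝ} (hs₀ : 0 ≤ s₀)
    (hbudget : 8 * 3800 * (((P.d + 2) * P.L : ℕ) : ℝ) ^ 2 * (P.L : ℝ) ^ (j + 1) * s₀ ≤ 1)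
    (hguard : 8 * (((P.d + 2) * P.L : ℕ) : ℝ) * (P.L : ℝ) ^ (j + 1) * s₀ ≤ θ)
    (hU : ∀ b : PBond P 0, iterBlockOf (j + 1) b.src = z → iterBlockOf (j + 1) b.tgt = z → ‖((U b : 𝔸ˣ) : 𝔸) - 1‖ ≤ s₀)
    (hpU : ∀ b : PBond P 0, iterBlockOf (j + 1) b.src = z → iterBlockOf (j + 1) b.tgt = z → p ((U b : 𝔸ˣ) : 𝔸)) :
    p ((vframeU (dbarIterU j U) z : 𝔸ˣ) : 𝔸) := by
  set ℓ : ℝ := (((P.d + 2) * P.L : ℕ) : ℝ) with hℓ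
  have hL1 : (1 : ℝ) ≤ P.L := by exact_mod_cast P.L_pos
  have hpow : (P.L : ℝ) ^ j ≤ (P.L : ℝ) ^ (j + 1) := pow_le_pow_right₀ hL1 (Nat.le_succ j)
  have hbudget_j : 8 * 3800 * ℓ ^ 2 * (P.L : ℝ) ^ j * s₀ ≤ 1 := by
    refine le_trans ?_ hbudget
    have h0 : 0 ≤ 8 * 3800 * ℓ ^ 2 * s₀ := by positivity
    nlinarith
  have hguard_j : 8 * ℓ * (P.L : ℝ) ^ j * s₀ ≤ θ := by
    refine le_trans ?_ hguard
    have h0 : 0 ≤ 8 * ℓ * s₀ := by positivity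
    nlinarith
  set S' : Set (Site P j) := {y | blockOf y = z} with hS'
  have hU' : ∀ b : PBond P 0, iterBlockOf j b.src ∈ S' → iterBlockOf j b.tgt ∈ S' → ‖((U b : 𝔸ˣ) : 𝔸) - 1‖ ≤ s₀ :=
    fun b hs ht => hU b (by rw [iterBlockOf_succ]; exact hs) (by rw [iterBlockOf_succ]; exact ht)
  have hpU' : ∀ b : PBond P 0, iterBlockOf j b.src ∈ S' → iterBlockOf j b.tgt ∈ S' → p ((U b : 𝔸ˣ) : 𝔸) :=
    fun b hs ht => hpU b (by rw [iterBlockOf_succ]; exact hs) (by rw [iterBlockOf_succ]; exact ht)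
  have hF : ∀ e : PBond P j, e.src ∈ S' → e.tgt ∈ S' → p ((dbarIterU j U e : 𝔸ˣ) : 𝔸) :=
    pred_dbarIterU_of_reads_of_le p h1 hmul hinv hθ heml j (Nat.le_of_succ_le hj) S' U s₀ hs₀ hbudget_j hguard_j hU' hpU'
  have hnear : ∀ e : PBond P j, e.src ∈ S' → e.tgt ∈ S' → ‖((dbarIterU j U e : 𝔸ˣ) : 𝔸) - 1‖ ≤ 2 * ((P.L : ℝ) ^ j * s₀) :=
    fun e hs ht => norm_dbarIterU_sub_one_le_two_mul₀ (Nat.le_of_succ_le hj) S' U hs₀ hbudget_j hU' e hs ht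
  have h2x : 0 ≤ 2 * ((P.L : ℝ) ^ j * s₀) := by positivity
  have h4 : 4 * (((P.d + 2) * P.L : ℕ) : ℝ) * (2 * ((P.L : ℝ) ^ j * s₀)) ≤ θ := by
    rw [← hℓ]
    have : 4 * ℓ * (2 * ((P.L : ℝ) ^ j * s₀)) = 8 * ℓ * (P.L : ℝ) ^ j * s₀ := by ring
    rw [this]; exact hguard_j
  exact pred_vframeU_of_le p h1 hmul hinv hθ heml hj (dbarIterU j U) z h2x h4 (fun b hs ht => hnear b hs ht) fun b hs ht => hF b hs ht

end Generic

/-! ## §2 The instance «the matrix is in `SU(N)`» with the (0.4) guard `δ_N` -/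

section SU

variable {N : ℕ} [NeZero N]

omit [NeZero N] in
/-- `p 1` for «`∃ s : SU(N), ↑s = ·`». [cite: Balaban1985Averaging, (19) p.21] -/
theorem suN_pred_one : ∃ s : Matrix.specialUnitaryGroup (Fin N) ℂ, (s : Matrix (Fin N) (Fin N) ℂ) = (1 : Matrix (Fin N) (Fin N) ℂ) := ⟨1, rfl⟩

omit [NeZero N] in
/-- closure under products. [cite: Balaban1985Averaging, (19) p.21] -/
theorem suN_pred_mul (a b : Matrix (Fin N) (Fin N) ℂ) (ha : ∃ s : Matrix.specialUnitaryGroup (Fin N) ℂ, (s : Matrix (Fin N) (Fin N) ℂ) = a)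
    (hb : ∃ s : Matrix.specialUnitaryGroup (Fin N) ℂ, (s : Matrix (Fin N) (Fin N) ℂ) = b) :
    ∃ s : Matrix.specialUnitaryGroup (Fin N) ℂ, (s : Matrix (Fin N) (Fin N) ℂ) = a * b := by
  obtain ⟨s, rfl⟩ := ha
  obtain ⟨t, rfl⟩ := hb
  exact ⟨s * t, rfl⟩

omit [NeZero N] in
/-- closure under inverses of units. [cite: Balaban1985Averaging, (19) p.21] -/
theorem suN_pred_inv (u : (Matrix (Fin N) (Fin N) ℂ)ˣ) (hu : ∃ s : Matrix.specialUnitaryGroup (Fin N) ℂ, (s : Matrix (Fin N) (Fin N) ℂ) = (u : Matrix (Fin N) (Fin N) ℂ)) :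
    ∃ s : Matrix.specialUnitaryGroup (Fin N) ℂ, (s : Matrix (Fin N) (Fin N) ℂ) = ((u⁻¹ : (Matrix (Fin N) (Fin N) ℂ)ˣ) : Matrix (Fin N) (Fin N) ℂ) := by
  obtain ⟨s, hs⟩ := hu
  refine ⟨s⁻¹, ?_⟩
  have hmul : (u : Matrix (Fin N) (Fin N) ℂ) * ((s⁻¹ : Matrix.specialUnitaryGroup (Fin N) ℂ) : Matrix (Fin N) (Fin N) ℂ) = 1 := by
    rw [← hs, ← Submonoid.coe_mul, mul_inv_cancel]; rfl
  exact (Units.inv_eq_of_mul_eq_one_right hmul).symm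

/-- `eml`-stability below the (0.4) guard: for `W_i ∈ SU(N)` with `‖W_i − 1‖ ≤ θ < δ_N = min(1∕3, π∕N)`, `eml W ∈ SU(N)` (lit ✓`eml_mem_specialUnitaryGroup`).
[cite: Balaban1987RG1, (0.9) p.253] -/
theorem suN_pred_eml {ι : Type*} [Fintype ι] {θ : ℝ} (hθ : θ < deltaSU (Fin N)) (W : ι → Matrix (Fin N) (Fin N) ℂ)
    (hW : ∀ i, ∃ s : Matrix.specialUnitaryGroup (Fin N) ℂ, (s : Matrix (Fin N) (Fin N) ℂ) = W i) (hs : ∀ i, ‖W i - 1‖ ≤ θ) :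
    ∃ s : Matrix.specialUnitaryGroup (Fin N) ℂ, (s : Matrix (Fin N) (Fin N) ℂ) = eml W := by
  have hmem : ∀ i, W i ∈ Matrix.specialUnitaryGroup (Fin N) ℂ := fun i => by obtain ⟨s, hs⟩ := hW i; rw [← hs]; exact s.2
  have hthird : ∀ i, ‖W i - 1‖ ≤ 1 / 3 := fun i => (hs i).trans (hθ.le.trans (min_le_left _ _))
  have hπ : ∀ i, Fintype.card (Fin N) * ‖W i - 1‖ < Real.pi := by
    intro i
    have hN : (0 : ℝ) < Fintype.card (Fin N) := by
      rw [Fintype.card_fin]; exact_mod_cast Nat.pos_of_ne_zero (NeZero.ne N)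
    have hlt : ‖W i - 1‖ < Real.pi / Fintype.card (Fin N) := lt_of_le_of_lt (hs i) (hθ.trans_le (min_le_right _ _))
    calc (Fintype.card (Fin N) : ℝ) * ‖W i - 1‖ < Fintype.card (Fin N) * (Real.pi / Fintype.card (Fin N)) := mul_lt_mul_of_pos_left hlt hN
      _ = Real.pi := mul_div_cancel₀ _ hN.ne'
  exact ⟨⟨eml W, eml_mem_specialUnitaryGroup hmem hthird hπ⟩, rfl⟩

/-- ★★ **THE FRAME `v(U̿^{(j)}U)(z)` IS IN `SU(N)`** when the fine field is `SU(N)`-valued and `s₀`-near-flat on the fine bonds under the `(j+1)`-block `z`, with the B2 budget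
`8·3800·ℓ²·L^{j+1}·s₀ ≤ 1` and the guard budget `8ℓ·L^{j+1}·s₀ ≤ θ < δ_N` — file 2's `hvf` at one block, every `N ≥ 1`.
[cite: Balaban1987RG1, (0.9) p.253; Balaban1985Averaging, (110) p.34, Prop. 4 (134)-(135) p.38] -/
theorem suN_vframeU_dbarIterU {j : ℕ} (hj : j + 1 ≤ P.m + P.K) (z : Site P (j + 1)) (U : GaugeField P 0 (Matrix (Fin N) (Fin N) ℂ)ˣ) {s₀ θ : ℝ} (hs₀ : 0 ≤ s₀)
    (hθ : θ < deltaSU (Fin N))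
    (hbudget : 8 * 3800 * (((P.d + 2) * P.L : ℕ) : ℝ) ^ 2 * (P.L : ℝ) ^ (j + 1) * s₀ ≤ 1)
    (hguard : 8 * (((P.d + 2) * P.L : ℕ) : ℝ) * (P.L : ℝ) ^ (j + 1) * s₀ ≤ θ)
    (hU : ∀ b : PBond P 0, iterBlockOf (j + 1) b.src = z → iterBlockOf (j + 1) b.tgt = z → ‖((U b : (Matrix (Fin N) (Fin N) ℂ)ˣ) : Matrix (Fin N) (Fin N) ℂ) - 1‖ ≤ s₀)
    (hsu : ∀ b : PBond P 0, iterBlockOf (j + 1) b.src = z → iterBlockOf (j + 1) b.tgt = z →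
      ∃ s : Matrix.specialUnitaryGroup (Fin N) ℂ, (s : Matrix (Fin N) (Fin N) ℂ) = ((U b : (Matrix (Fin N) (Fin N) ℂ)ˣ) : Matrix (Fin N) (Fin N) ℂ)) :
    ∃ s : Matrix.specialUnitaryGroup (Fin N) ℂ, (s : Matrix (Fin N) (Fin N) ℂ) = ((vframeU (dbarIterU j U) z : (Matrix (Fin N) (Fin N) ℂ)ˣ) : Matrix (Fin N) (Fin N) ℂ) :=
  have hθ1 : θ ≤ 1 := (hθ.le.trans (min_le_left _ _)).trans (by norm_num)
  pred_vframeU_dbarIterU_of_le (fun M : Matrix (Fin N) (Fin N) ℂ => ∃ s : Matrix.specialUnitaryGroup (Fin N) ℂ, (s : Matrix (Fin N) (Fin N) ℂ) = M)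
    suN_pred_one (fun a b ha hb => suN_pred_mul a b ha hb) (fun u hu => suN_pred_inv u hu) hθ1 (fun W hW hs' => suN_pred_eml hθ W hW hs') hj z U hs₀ hbudget hguard hU hsu

end SU

end Summit.QuantumFields.YangMills.Theorems.K0Stub1DoubleBarFramesSU

end
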